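import Literature.AlgebraicGeometry.Surfaces.K3PowersHodgeIffKugaSatakePowers
import Literature.AlgebraicGeometry.Motives.HodgeStructureK3TypeSignature
import HarnessLib

/-!
# Kuga–Satake varieties exist for EVERY polarized Hodge structure of K3 type (van Geemen 2000 §5.7, §8.1;
# Floccari 2026 §3.2) — the orthogonal-pair hypothesis removed — PROVED

Family `hodge`, layer `Literature/AlgebraicGeometry/Surfaces`. Theorems only (no definition, no named
fact, no instance).

The tree's `Surfaces.exists_isKugaSatakeVarietyBetti` (file `Surfaces/K3PowersHodgeIffKugaSatakePowers`)
produces, GIVEN Riemann's theorem in the form `HodgeTheory.DeligneMilne1982_Thm_6_20_essImage` (a theorem on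
the summit side) and GIVEN an orthogonal pair `e₁, e₂ ∈ T` with `P(eᵢ, eᵢ) < 0`, a complex abelian variety
`A` with `H¹_B(A) ≅` the Kuga–Satake structure of a finite-dimensional polarized Hodge structure `(T, H, P)`
of K3 type. The pair always exists — van Geemen §5.2 "`Q` has signature `(2-, (n-2)+)`", PROVED in the tree
as `Motives.HodgeStructure.Polarization.exists_orthogonal_pair_form_self_neg` (file
`Motives/HodgeStructureK3TypeSignature`: Hodge–Riemann II and a dimension count against
`T^{2,0} ⊕ T^{0,2}`) — so the hypothesis is dropped here: `exists_isKugaSatakeVarietyBetti_of_isOfK3Type`.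
For a PRESENTATION `(T, H, P, ε, j)` of the transcendental part of a smooth projective surface
(`HodgeTheory.IsTranscendentalPartBetti`, the carrier language of the cell's Kuga–Satake records) the K3-type
hypothesis reduces to `h^{2,0}(T) = 1` (`isOfK3Type_of_isTranscendentalPartBetti`: the other pieces vanish
because `j` embeds `T` into `H²_B(S)`; `finite_of_isTranscendentalPartBetti`), whence
`exists_isKugaSatakeVarietyBetti_of_isTranscendentalPartBetti`: Kuga–Satake varieties exist for every
presentation with `h^{2,0}(T) = 1` — the binder shape of `IsKSCorrespondenceAlgebraicBetti` ∕ Floccari Thm. 3.5.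

## References

* [vanGeemen2000KugaSatakeHC] B. van Geemen, Kuga-Satake varieties and the Hodge conjecture (2000), §5.2
  (arXiv math/9903146 p. 8 L23–27), §5.7, §8.1.
* [Floccari2026] S. Floccari, §3.2 ("This thus defines an abelian variety `KS(V)` up to isogeny").

## Provenance

Cell `hodge-nonav` (summit `HodgeConjecture`, rung F-H1), seat `littype-FH1-2` (literature-prover,
generation 18); consumer shape: `Summit.HodgeConjecture.CorCM.Stage4.exists_isKugaSatakeVarietyBetti`
(which feeds `hDM` with the summit theorem `CorCM.deligneMilne1982_Thm_6_20_essImage_holds`).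
-/

noncomputable section

namespace Literature.AlgebraicGeometry.Surfaces

/-- **Kuga–Satake varieties exist on the real carriers for every finite-dimensional polarized `ℚ`-Hodge
structure of K3 type** (no orthogonal-pair hypothesis): given Riemann's theorem
`HodgeTheory.DeligneMilne1982_Thm_6_20_essImage`, there are a complex abelian variety `A`, a Hodge-symmetric
Hodge model `B` and `θ : H¹(A(ℂ); ℚ) ≃ C⁺(Q)` with `IsKugaSatakeVarietyBetti H P _ A B hB θ` — the tree's
`exists_isKugaSatakeVarietyBetti` with its pair `e₁ ⊥ e₂`, `P(eᵢ, eᵢ) < 0` supplied by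
`Polarization.exists_orthogonal_pair_form_self_neg` (vG §5.2). [cite: vanGeemen2000KugaSatakeHC, §5.7 and §8.1]
[cite: Floccari2026, §3.2] -/
theorem exists_isKugaSatakeVarietyBetti_of_isOfK3Type (hDM : HodgeTheory.DeligneMilne1982_Thm_6_20_essImage)
    {T : Type} [AddCommGroup T] [Module ℚ T] [Module.Finite ℚ T] (H : Motives.HodgeStructure T 2)
    (P : H.Polarization) (hK3 : H.IsOfK3Type) :
    ∃ (A : Motives.AbelianVariety ℂ) (B : HodgeTheory.HodgeModel A.dim A.X) (hB : B.IsHodgeSymmetric)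
      (θ : Motives.bettiCohomology A.X 1 ≃ₗ[ℚ] CliffordAlgebra.even P.quadraticForm),
      HodgeTheory.IsKugaSatakeVarietyBetti H P hK3.1 A B hB θ :=
  exists_isKugaSatakeVarietyBetti hDM H P hK3 (P.exists_orthogonal_pair_form_self_neg H hK3)

/-! ### From a presentation of the transcendental part of a surface: `h^{2,0}(T) = 1` suffices -/

section Presentation

open HodgeTheory
open Literature.AlgebraicTopology.SingularHomology

variable {S : Motives.SchemeOver ℂ} {hS : Motives.IsSmoothProjective 2 S}
  {M : HodgeModel 2 S} {hM : M.IsHodgeSymmetric}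
  {T : Type} [AddCommGroup T] [Module ℚ T] {H : Motives.HodgeStructure T 2} {P : H.Polarization}
  {ε : ℤˣ} {j : H.Hom (bettiTwoHodgeStructure hS M hM)}

/-- **The Hodge pieces `T^{p,q}` of a presentation of the transcendental part of a smooth projective
surface vanish for `p < 0` or `q < 0`** (`IsTranscendentalPartBetti`: `j` is an injective morphism of Hodge
structures into `H²_B(S)`; `j_ℂ` maps `T^{p,q}` into `H²_B(S)^{p,q}`, `Hom.map_piece_le`, and the pieces of
the Hodge structure of a Hodge model vanish there, `HodgeModel.ratF_eq_bot`). The surface twin of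
`Hyperkaehler.Huybrechts1999_k3HilbertType_transcendentalPart_signature.piece_eq_bot_of_neg`.
[cite: VoisinHodgeI2002, §7.1.1 and §7.3.1 Def. 7.22] [cite: vanGeemen2000KugaSatakeHC, §10.1–10.2] -/
theorem piece_eq_bot_of_neg_of_isTranscendentalPartBetti (hT : IsTranscendentalPartBetti hS M hM H P ε j)
    {p q : ℤ} (hpq : p < 0 ∨ q < 0) : H.piece p q = ⊥ := by
  have hinj : Function.Injective (j.toLinearMap.baseChange ℂ) := by
    rw [LinearMap.baseChange_eq_ltensor]
    exact Module.Flat.lTensor_preserves_injective_linearMap _ hT.1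
  have htarget : ∀ y, y ∈ (bettiTwoHodgeStructure hS M hM).piece p q → y = 0 := by
    intro y hy
    have hy' : y ∈ (M.hodgeStructure hS hM (2 * 1)).piece p q := by
      simpa only [Motives.HodgeStructure.cast_piece] using hy
    by_cases hPQ : p + q = ((2 * 1 : ℕ) : ℤ)
    · rw [Motives.HodgeStructure.mem_piece_iff _ hPQ, HodgeModel.hodgeStructure_F,
        HodgeModel.hodgeStructure_F] at hy'
      rcases hpq with hP | hQ
      · rw [M.ratF_eq_bot hS (2 * 1) (show ((2 * 1 : ℕ) : ℤ) < q by omega), Submodule.mem_bot] at hy'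
        have h2 := congrArg Motives.HodgeStructure.conj hy'.2
        rwa [Motives.HodgeStructure.conj_conj, map_zero] at h2
      · rw [M.ratF_eq_bot hS (2 * 1) (show ((2 * 1 : ℕ) : ℤ) < p by omega), Submodule.mem_bot] at hy'
        exact hy'.1
    · rw [Motives.HodgeStructure.piece_eq_bot_of_add_ne _ hPQ, Submodule.mem_bot] at hy'
      exact hy'
  rw [Submodule.eq_bot_iff]
  intro x hx
  have h := htarget _ (j.map_piece_le p q ⟨x, hx, rfl⟩)
  exact hinj (by rw [h, map_zero])

/-- **The carrier `T` of a presentation of the transcendental part of a smooth projective surface is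
finite-dimensional** (`T ↪ H²(S(ℂ); ℚ)`, `S(ℂ)` a compact `4`-manifold).
[cite: vanGeemen2000KugaSatakeHC, §10.1–10.2] [cite: VoisinHodgeI2002, §7.1.1] -/
theorem finite_of_isTranscendentalPartBetti (hT : IsTranscendentalPartBetti hS M hM H P ε j) :
    Module.Finite ℚ T := by
  letI := hS.chartedSpace
  haveI := Motives.ComplexPoints.compactSpace_of_isSmoothProjective hS
  haveI := Motives.ComplexPoints.t2Space_of_isSmoothProjective hS
  haveI : Module.Finite ℚ (Motives.bettiCohomology S (2 * 1)) :=
    finite_singularCohomology_of_compact_chartedSpace ℚ ℚ (d := 2 * 2) (2 * 1)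
  exact Module.Finite.of_injective j.toLinearMap hT.1

/-- **A presentation of the transcendental part of a surface with `h^{2,0}(T) = 1` is a Hodge structure of
K3 type** (`Motives.HodgeStructure.IsOfK3Type`; the vanishing of `T^{p,q}` for `|p - q| > 2` is automatic,
`piece_eq_bot_of_neg_of_isTranscendentalPartBetti`). [cite: Huybrechts2016K3, Ch. 3 Def. 2.3 and Lemma 3.1]
[cite: vanGeemen2000KugaSatakeHC, §10.2] -/
theorem isOfK3Type_of_isTranscendentalPartBetti (hT : IsTranscendentalPartBetti hS M hM H P ε j)
    (h20 : H.hodgeNumber 2 0 = 1) : H.IsOfK3Type := by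
  refine ⟨h20, fun p q hpq => ?_⟩
  by_cases hsum : p + q = 2
  · refine piece_eq_bot_of_neg_of_isTranscendentalPartBetti hT ?_
    rcases lt_abs.1 hpq with h | h
    · right; omega
    · left; omega
  · exact Motives.HodgeStructure.piece_eq_bot_of_add_ne _ hsum

/-- **Kuga–Satake varieties exist for every presentation `(T, H, P, ε, j)` of the transcendental part of a
smooth projective surface with `h^{2,0}(T) = 1`** (given Riemann's theorem
`HodgeTheory.DeligneMilne1982_Thm_6_20_essImage`): the `∀ (A, B, θ)` binder of the Kuga–Satake records
(`IsKSCorrespondenceAlgebraicBetti`, Floccari 2026 Thm. 3.5) is inhabited for EVERY presentation — no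
K3-type and no orthogonal-pair hypothesis left (`isOfK3Type_of_isTranscendentalPartBetti`,
`finite_of_isTranscendentalPartBetti`, `exists_isKugaSatakeVarietyBetti_of_isOfK3Type`).
[cite: vanGeemen2000KugaSatakeHC, §5.7, §8.1 and §10.2] [cite: Floccari2026, §3.2] -/
theorem exists_isKugaSatakeVarietyBetti_of_isTranscendentalPartBetti
    (hDM : HodgeTheory.DeligneMilne1982_Thm_6_20_essImage)
    (hT : IsTranscendentalPartBetti hS M hM H P ε j) (h20 : H.hodgeNumber 2 0 = 1) :
    ∃ (A : Motives.AbelianVariety ℂ) (B : HodgeTheory.HodgeModel A.dim A.X) (hB : B.IsHodgeSymmetric)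
      (θ : Motives.bettiCohomology A.X 1 ≃ₗ[ℚ] CliffordAlgebra.even P.quadraticForm),
      HodgeTheory.IsKugaSatakeVarietyBetti H P h20 A B hB θ := by
  haveI : Module.Finite ℚ T := finite_of_isTranscendentalPartBetti hT
  exact exists_isKugaSatakeVarietyBetti_of_isOfK3Type hDM H P (isOfK3Type_of_isTranscendentalPartBetti hT h20)

end Presentation

end Literature.AlgebraicGeometry.Surfaces

end
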